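import Summits.KontsevichZagierPeriods.KontsevichZagierPeriods.Theorems.StuffleInKZ.Negative.IntegrandAdditivityDerived
import Summits.KontsevichZagierPeriods.KontsevichZagierPeriods.Theorems.StokesGeneration.Negative.IffSummit

/-!
# `StokesGeneration` (stmt-KontsevichZagierPeriods-3586) — the crux is three-rule generation of `ker eval`

cdisprove (refuter) corollary for the crux `StokesGeneration` of route
`KontsevichZagierPeriods/UnfoldedStokes`. Rule (1b) (integrand additivity) of the calculus of
`KZCalculus.lean` is derivable from rules (1a) + (3) — ALREADY in the tree as
`StuffleInKZ.Negative.Derived.integrandAddRel_subset_closure_domAdd_nl` /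
`relations_eq_closure_three_rules` (the survivor; this seat's independent smoothstep proof,
proposal p111298, was withdrawn as a duplicate, and its landed auxiliary file
`Negative/IntegrandAddRedundantAux.lean` is thereby orphaned — librarian note). Combined with the
calibration `stokesGeneration_iff_kernel` (`Negative/IffSummit.lean`), the crux is, unconditionally,
the statement that `ker eval` is generated by domain additivity, change of variables and
Newton–Leibniz alone: an invariant-based refutation (route Neg) need only kill rules (1a), (2), (3)
(each of which IS load-bearing: `Negative/NewtonLeibnizLoadBearing.lean`,
`Negative/CovDomainAddLoadBearing.lean`).

[Kontsevich–Zagier 2001, §1.2 rules (1)–(3), Conjecture 1]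
-/

noncomputable section

namespace Summit.KontsevichZagierPeriods.UnfoldedStokes.StokesGenerationNegative

open Literature.NumberTheory.Transcendental
open Literature.NumberTheory.Transcendental.KZ
open Summit.KontsevichZagierPeriods.KontsevichZagierPeriods.Theses.UnfoldedStokes (StokesGeneration)
open Summit.KontsevichZagierPeriods.Theorems.StuffleInKZ.Negative.Derived (relations_eq_closure_three_rules)

/-- The kernel conjecture is the statement that `ker eval` is generated by rules (1a), (2), (3)
(rule (1b) being derivable, tree `relations_eq_closure_three_rules`).
[cite: KontsevichZagier2001, §1.2 Conjecture 1] -/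
theorem kzKernelConjecture_iff_threeRules :
    KZKernelConjecture ↔ ∀ x : FormalRep, eval x = 0 →
      x ∈ AddSubgroup.closure (domainAddRel ∪ changeOfVariablesRel ∪ newtonLeibnizRel) := by
  unfold KZKernelConjecture
  rw [relations_eq_closure_three_rules]

/-- **The crux with three rules** (unconditional): `StokesGeneration` holds iff `ker eval` is
generated by domain additivity, change of variables and Newton–Leibniz.
[cite: KontsevichZagier2001, §1.2 Conjecture 1] -/
theorem stokesGeneration_iff_threeRules :
    StokesGeneration ↔ ∀ x : FormalRep, eval x = 0 →
      x ∈ AddSubgroup.closure (domainAddRel ∪ changeOfVariablesRel ∪ newtonLeibnizRel) :=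
  stokesGeneration_iff_kernel.trans kzKernelConjecture_iff_threeRules

end Summit.KontsevichZagierPeriods.UnfoldedStokes.StokesGenerationNegative
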